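import Literature.Computability.QuantumComplexity.FactoringProofs
import Literature.Computability.Complexity.ListFoldChecks
import HarnessLib

/-!
# `PRIMES ∈ UP` from a polynomial-time primality test for numbers with factored `p − 1`

Family `PQC`, companion of `PrattMachine.lean` / `FactoringProofs.lean` (`PRIMES ∈ NP`, Pratt) and of
the fact `FACT_mem_UP_inter_coUP` (`Factoring.lean`, pqc.S26). Pratt's certificate of a prime `p` — the
Lucas tree: `p`, a primitive root, and recursively the certificates of the primes of `p − 1` — is not
unique (the primitive roots are a choice). Fellows–Koblitz 1992, Lemma 1, replace the primitive root by
a *deterministic* polynomial-time test deciding primality of `p` from the list of prime factors of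
`p − 1`; the certificate of the proof of their Thm. 1 ("purported prime factorizations `pⱼ − 1 = ∏ qₖ`,
…, each purported prime certified by Lemma 1") then has no choices left. This file proves the
resulting *unambiguity* abstractly, for any such test given as a brick of the tree's `FP` algebra:

* `PrimesUP.treeSet p` — the vertex set of the Lucas tree of `p` (the heads of `Pratt.lines p`), its
  closure and parent properties, `card_treeSet_lt` (`< 2 size p`, Pratt's count), and the
  characterisation `eq_treeSet` (the unique finite set `K ∋ p` of numbers `≤ p`, closed under prime
  factors of `r − 1`, in which every `r ≠ p` has a parent);
* the witness `primesWit p = encList [⟨r, primeFactorsList (r − 1)⟩ : r ∈ treeSet p increasing]` and the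
  verifier `primesUpFn T` (canonical coding by the re-listing folds `revMapFn`, strictly increasing
  keys, `p` a key, per item: `2 ≤ r ≤ p`, the factor list sorted with product `r − 1` and drawn from
  the keys, `T` accepts; minimality: every key is `p` or divides some `r' − 1`), in `FP` for `T ∈ FP`;
* `IsFactoredPrimalityTest T`: `T ∈ FP` is one-bit and
  `T ⟨encodeNat p, encList (primeFactorsList (p − 1))⟩ = [p.Prime]` for `p ≥ 2`;
* soundness with uniqueness (`eq_primesWit_of_primesUpFn`: an accepted `⟨x, y⟩` has `x = encodeNat p`,
  `p` prime and `y = primesWit p`, by strong induction on the keys and `eq_treeSet`), completeness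
  (`primesUpFn_primesWit`), succinctness (`|primesWit p| ≤ 32 size² p + 12 size p`), and
  **`PRIMES_mem_UP_of_isFactoredPrimalityTest : IsFactoredPrimalityTest T → PRIMES ∈ UP`**.

With `FactoringUP.lean` (`FACT_mem_UP_inter_coUP_of_PRIMES_mem_UP`) this reduces pqc.S26 (`UP` form)
to the machine form of Fellows–Koblitz's Lemma 1, developed elsewhere in the tree
(`Literature/NumberTheory/Primality/SmoothNumbersLowerBound.lean` and its sequels); nothing of that
line is restated here.

## References

* M. R. Fellows, N. Koblitz, *Self-witnessing polynomial-time complexity and prime factorization*,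
  Designs, Codes and Cryptography 2 (1992) 231–235; Proc. 7th Structure in Complexity Theory (1992)
  107–110: §2, Lemma 1 and the proof of Thm. 1 (held: `doi:10.1007/bf00141967`, pp. 2–4).
* V. Pratt, *Every prime has a succinct certificate*, SIAM J. Comput. 4 (1975) 214–220.
* R. Crandall, C. Pomerance, *Prime numbers: a computational perspective*, Springer, §4.1.3, Thm 4.1.9
  (the Lucas tree and its size).
* L. Valiant, *Relative complexity of checking and evaluating*, Inf. Proc. Lett. 5 (1976) 20–23 (`UP`).
* S. Arora, B. Barak, *Computational Complexity: A Modern Approach*, CUP 2009, §1.3, Def. 9.14.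
-/

namespace Literature.Computability.QuantumComplexity

open _root_.Computability Complexity Complexity.Classes Complexity.Nondeterministic Complexity.Brick Polynomial
open Literature.NumberTheory.Primality

namespace PrimesUP

/-! ### The vertex set of the Lucas tree -/

/-- The first field of the line of `r` is `r`. [folklore] -/
@[simp] theorem fst_line (r : ℕ) : (Pratt.line r).1 = r := rfl

/-- **The vertex set of the Lucas tree of `p`**: the heads of the lines of its Pratt certificate
(`p`, the primes of `p − 1`, the primes of `q − 1` for those, …). [cite: CrandallPomerance1999, §4.1.3 (Lucas tree)] -/
noncomputable def treeSet (p : ℕ) : Finset ℕ := ((Pratt.lines p).map fun l => l.1).toFinset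

/-- Membership in the vertex set is being a head of the certificate. [folklore] -/
theorem mem_treeSet_iff {p r : ℕ} : r ∈ treeSet p ↔ r ∈ Pratt.heads (Pratt.lines p) := by
  simp [treeSet, Pratt.heads]

/-- A head of a line of the certificate is a vertex. [folklore] -/
theorem mem_treeSet_of_line_mem {p r : ℕ} (h : Pratt.line r ∈ Pratt.lines p) : r ∈ treeSet p :=
  mem_treeSet_iff.2 ⟨Pratt.line r, h, rfl⟩

/-- The line of a vertex is a line of the certificate. [folklore] -/
theorem line_mem_lines_of_mem_treeSet {p r : ℕ} (hp : 0 < p) (hr : r ∈ treeSet p) :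
    Pratt.line r ∈ Pratt.lines p := by
  obtain ⟨l, hl, hl1⟩ := mem_treeSet_iff.1 hr
  obtain ⟨r', -, -, rfl⟩ := Pratt.mem_lines_iff hp hl
  have : r' = r := hl1
  subst this
  exact hl

/-- `p` is a vertex of its tree. [folklore] -/
theorem self_mem_treeSet {p : ℕ} (hp : 0 < p) : p ∈ treeSet p := mem_treeSet_iff.2 (Pratt.mem_heads_lines hp)

/-- Vertices are positive and at most `p`. [folklore] -/
theorem pos_and_le_of_mem_treeSet {p r : ℕ} (hp : 0 < p) (hr : r ∈ treeSet p) : 0 < r ∧ r ≤ p := by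
  obtain ⟨l, hl, hl1⟩ := mem_treeSet_iff.1 hr
  obtain ⟨r', hr', hr'p, rfl⟩ := Pratt.mem_lines_iff hp hl
  have : r' = r := hl1
  subst this
  exact ⟨hr', hr'p⟩

/-- **Subtrees**: if the line of `r` occurs in the certificate of `p` then the whole certificate of
`r` does. [cite: CrandallPomerance1999, §4.1.3 (Lucas tree)] -/
theorem lines_subset_of_line_mem : ∀ {p : ℕ}, 0 < p → ∀ {r : ℕ},
    Pratt.line r ∈ Pratt.lines p → Pratt.lines r ⊆ Pratt.lines p := by
  intro p
  induction p using Nat.strong_induction_on with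
  | _ p ih =>
    intro hp r hr
    rw [Pratt.lines_eq hp, List.mem_cons, List.mem_flatMap] at hr
    rcases hr with h | ⟨q, hq, hl⟩
    · have : r = p := congrArg Prod.fst h
      subst this
      exact fun _ h' => h'
    · have hq' := Pratt.lt_of_mem_primeFactorsList_sub_one hq
      exact fun l' hl' => Pratt.lines_subset_of_mem hq (ih q hq' (Nat.prime_of_mem_primeFactorsList hq).pos hl hl')

/-- **Closure**: the prime factors of `r − 1`, `r` a vertex, are vertices. [cite: CrandallPomerance1999, §4.1.3 (Lucas tree)] -/
theorem treeSet_closed {p r q : ℕ} (hp : 0 < p) (hr : r ∈ treeSet p) (hq : q ∈ (r - 1).primeFactorsList) :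
    q ∈ treeSet p :=
  mem_treeSet_of_line_mem (lines_subset_of_line_mem hp (line_mem_lines_of_mem_treeSet hp hr)
    (Pratt.lines_subset_of_mem hq (Pratt.line_mem_lines (Nat.prime_of_mem_primeFactorsList hq).pos)))

/-- Unfolding the vertex set: `p` and the vertex sets of the primes of `p − 1`. [folklore] -/
theorem mem_treeSet_iff_of_pos {p r : ℕ} (hp : 0 < p) :
    r ∈ treeSet p ↔ r = p ∨ ∃ q ∈ (p - 1).primeFactorsList, r ∈ treeSet q := by
  simp only [mem_treeSet_iff, Pratt.heads, Set.mem_setOf_eq]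
  rw [Pratt.lines_eq hp]
  constructor
  · rintro ⟨l, hl, rfl⟩
    rcases List.mem_cons.1 hl with rfl | hl
    · exact Or.inl rfl
    · obtain ⟨q, hq, hlq⟩ := List.mem_flatMap.1 hl
      exact Or.inr ⟨q, hq, l, hlq, rfl⟩
  · rintro (rfl | ⟨q, hq, l, hl, rfl⟩)
    · exact ⟨Pratt.line r, List.mem_cons_self, rfl⟩
    · exact ⟨l, List.mem_cons_of_mem _ (List.mem_flatMap.2 ⟨q, hq, hl⟩), rfl⟩

/-- **Parents**: every vertex other than the root divides `r' − 1` for some vertex `r'`. [cite: CrandallPomerance1999, §4.1.3 (Lucas tree)] -/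
theorem exists_parent_of_mem_treeSet : ∀ {p : ℕ}, 0 < p → ∀ {r : ℕ}, r ∈ treeSet p → r ≠ p →
    ∃ r' ∈ treeSet p, r ∈ (r' - 1).primeFactorsList := by
  intro p
  induction p using Nat.strong_induction_on with
  | _ p ih =>
    intro hp r hr hne
    rcases (mem_treeSet_iff_of_pos hp).1 hr with rfl | ⟨q, hq, hrq⟩
    · exact absurd rfl hne
    · have hq' := Pratt.lt_of_mem_primeFactorsList_sub_one hq
      have hqpos := (Nat.prime_of_mem_primeFactorsList hq).pos
      by_cases hrq' : r = q
      · subst hrq'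
        exact ⟨p, self_mem_treeSet hp, hq⟩
      · obtain ⟨r', hr', hrr'⟩ := ih q hq' hqpos hrq hrq'
        exact ⟨r', (mem_treeSet_iff_of_pos hp).2 (Or.inr ⟨q, hq, hr'⟩), hrr'⟩

/-- The vertices of the tree of a prime are primes (Lucas's criterion along the certificate).
[cite: Pratt1975, pp. 214–220] -/
theorem prime_of_mem_treeSet {p r : ℕ} (hp : p.Prime) (hr : r ∈ treeSet p) : r.Prime :=
  (Pratt.certValid_lines hp).prime_of_mem_heads (mem_treeSet_iff.1 hr)

/-- **Pratt's count**: fewer than `2 size p − 1` vertices. [cite: CrandallPomerance1999, Thm 4.1.9] -/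
theorem card_treeSet_lt {p : ℕ} (hp : p.Prime) : (treeSet p).card + 1 < 2 * p.size := by
  have h1 : (treeSet p).card ≤ (Pratt.lines p).length :=
    (List.toFinset_card_le _).trans (by rw [List.length_map])
  have := Pratt.length_lines_lt hp
  omega

/-- **Characterisation of the vertex set**: a finite set `K ∋ p` of numbers `≤ p`, closed under the
prime factors of `r − 1` and in which every `r ≠ p` divides some `r' − 1` (`r' ∈ K`), is `treeSet p`.
This is the uniqueness of the choice-free certificate. [cite: FellowsKoblitz1992, §2 (proof of Thm. 1)] -/
theorem eq_treeSet {p : ℕ} (hp : 0 < p) {K : Finset ℕ} (h1 : p ∈ K)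
    (h2 : ∀ r ∈ K, ∀ q ∈ (r - 1).primeFactorsList, q ∈ K) (h3 : ∀ r ∈ K, r ≤ p)
    (h4 : ∀ r ∈ K, r = p ∨ ∃ r' ∈ K, r ∈ (r' - 1).primeFactorsList) : K = treeSet p := by
  apply Finset.Subset.antisymm
  · suffices key : ∀ n r, p - r = n → r ∈ K → r ∈ treeSet p from fun r hr => key _ r rfl hr
    intro n
    induction n using Nat.strong_induction_on with
    | _ n ih =>
      intro r hn hr
      rcases h4 r hr with rfl | ⟨r', hr', hrr'⟩
      · exact self_mem_treeSet hp
      · have hlt := Pratt.lt_of_mem_primeFactorsList_sub_one hrr'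
        have hle := h3 r' hr'
        exact treeSet_closed hp (ih (p - r') (by omega) r' rfl hr') hrr'
  · have key : ∀ p', 0 < p' → p' ∈ K → ∀ r ∈ treeSet p', r ∈ K := by
      intro p'
      induction p' using Nat.strong_induction_on with
      | _ p' ih =>
        intro hp' hK r hr
        rcases (mem_treeSet_iff_of_pos hp').1 hr with rfl | ⟨q, hq, hrq⟩
        · exact hK
        · exact ih q (Pratt.lt_of_mem_primeFactorsList_sub_one hq) (Nat.prime_of_mem_primeFactorsList hq).pos
            (h2 p' hK q hq) r hrq
    exact fun r hr => key p hp h1 r hr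

/-! ### Coded items `⟨r, [q₁, …, qₖ]⟩` and the witness -/

/-- The code of a list of factors: the coded list of their numerals. [cite: AroraBarakCC2009, §0.1 (coding of lists)] -/
def encFactors (F : List ℕ) : List Bool := encList (F.map encodeNat)

/-- The code of an item `(r, F)`: `⟨encodeNat r, encFactors F⟩`. [folklore] -/
def encItem (rF : ℕ × List ℕ) : List Bool := boolPair (encodeNat rF.1) (encFactors rF.2)

/-- The code of a list of items. [folklore] -/
def encItemsT (l : List (ℕ × List ℕ)) : List Bool := encList (l.map encItem)

/-- Reading the factors back. [folklore] -/
@[simp] theorem decNil_encFactors (F : List ℕ) : decNil (encFactors F) = F.map encodeNat := by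
  rw [encFactors, decNil_encList]

/-- Reading the items back. [folklore] -/
@[simp] theorem decNil_encItemsT (l : List (ℕ × List ℕ)) : decNil (encItemsT l) = l.map encItem := by
  rw [encItemsT, decNil_encList]

/-- The key of a coded item. [folklore] -/
@[simp] theorem fstF_encItem (rF : ℕ × List ℕ) : fstF (encItem rF) = encodeNat rF.1 := by simp [encItem]

/-- The factor field of a coded item. [folklore] -/
@[simp] theorem sndF_encItem (rF : ℕ × List ℕ) : sndF (encItem rF) = encFactors rF.2 := by simp [encItem]

/-- The vertices in increasing order. [folklore] -/
noncomputable def treeList (p : ℕ) : List ℕ := (treeSet p).sort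

/-- **The unambiguous certificate of a prime `p`**: the vertices `r` of its Lucas tree in increasing
order, each with the prime factorisation of `r − 1`. [cite: FellowsKoblitz1992, §2 (proof of Thm. 1)] -/
noncomputable def primesWit (p : ℕ) : List Bool :=
  encItemsT ((treeList p).map fun r => (r, (r - 1).primeFactorsList))

/-! ### Re-listing folds and the canonical form of items -/

/-- The step `⟨u, ⟨a, acc⟩⟩ ↦ ⟨f a, acc⟩` of the re-listing fold. [folklore] -/
noncomputable def consMapStep (f : List Bool → List Bool) : List Bool → List Bool :=
  fanoutFn (f ∘ fstF ∘ sndF) (sndF ∘ sndF)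

/-- `consMapStep f ∈ FP` for `f ∈ FP`. [folklore] -/
theorem consMapStep_mem_FP {f : List Bool → List Bool} (hf : f ∈ FP) : consMapStep f ∈ FP :=
  fanoutFn_mem_FP (comp_mem_FP hf (comp_mem_FP fstF_mem_FP sndF_mem_FP)) (comp_mem_FP sndF_mem_FP sndF_mem_FP)

/-- Value of the step. [folklore] -/
@[simp] theorem consMapStep_apply (f : List Bool → List Bool) (u a acc : List Bool) :
    consMapStep f (boolPair u (boolPair a acc)) = boolPair (f a) acc := by
  simp [consMapStep]

/-- Growth of the step for a non-lengthening `f`: `FoldGrowth 2`. [folklore] -/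
theorem foldGrowth_consMapStep {f : List Bool → List Bool} (hlen : ∀ a, (f a).length ≤ a.length) :
    FoldGrowth 2 (consMapStep f) := by
  intro v
  have h : consMapStep f v = boolPair (f (fstF (sndF v))) (sndF (sndF v)) := by
    simp only [consMapStep, fanoutFn_apply, Function.comp_apply]
  rw [h, length_boolPair]
  have := hlen (fstF (sndF v))
  omega

/-- **The re-listing fold** `revMapFn f L = encList (map f (items of L)).reverse`. [cite: AroraBarakCC2009, §1.3 (bounded loops)] -/
noncomputable def revMapFn (f : List Bool → List Bool) : List Bool → List Bool :=
  foldFn (consMapStep f) (fun _ => []) ∘ fanoutFn (fun _ => []) id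

/-- `revMapFn f ∈ FP` for a non-lengthening `f ∈ FP`. [cite: AroraBarakCC2009, §1.3] -/
theorem revMapFn_mem_FP {f : List Bool → List Bool} (hf : f ∈ FP) (hlen : ∀ a, (f a).length ≤ a.length) :
    revMapFn f ∈ FP :=
  comp_mem_FP (foldFn_mem_FP (consMapStep_mem_FP hf) (const_mem_FP _) (foldGrowth_consMapStep hlen))
    (fanoutFn_mem_FP (const_mem_FP _) (PolyTimeComputable.id _))

/-- The left fold of the step. [folklore] -/
theorem foldl_consMapStep (f : List Bool → List Bool) (w : List Bool) : ∀ (l l₀ : List (List Bool)),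
    l.foldl (fun acc a => consMapStep f (boolPair w (boolPair a acc))) (encList l₀) =
      encList ((l.map f).reverse ++ l₀)
  | [], l₀ => by simp
  | a :: l, l₀ => by
    rw [List.foldl_cons, consMapStep_apply, ← encList_cons, foldl_consMapStep f w l (f a :: l₀)]
    simp

/-- **Value of `revMapFn` on every input.** [folklore] -/
theorem revMapFn_apply (f : List Bool → List Bool) (L : List Bool) :
    revMapFn f L = encList ((decNil L).map f).reverse := by
  rw [revMapFn, Function.comp_apply, foldFn_apply, fanoutFn_apply, sndF_boolPair]
  have h0 : ([] : List Bool) = encList [] := rfl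
  rw [id, h0, foldl_consMapStep, List.append_nil]

/-- **Re-listing**: `relistFn L = encList (items of L)` (reverse twice). [folklore] -/
noncomputable def relistFn : List Bool → List Bool := revMapFn id ∘ revMapFn id

/-- `relistFn ∈ FP`. [folklore] -/
theorem relistFn_mem_FP : relistFn ∈ FP :=
  comp_mem_FP (revMapFn_mem_FP (PolyTimeComputable.id _) fun _ => le_rfl)
    (revMapFn_mem_FP (PolyTimeComputable.id _) fun _ => le_rfl)

/-- Value of `relistFn`. [folklore] -/
theorem relistFn_apply (L : List Bool) : relistFn L = encList (decNil L) := by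
  rw [relistFn, Function.comp_apply, revMapFn_apply, revMapFn_apply, decNil_encList, List.map_id, List.map_id,
    List.reverse_reverse]

/-- **Normalising a list of numerals**: `normListFn L = encList (map norm (items of L))`. [folklore] -/
noncomputable def normListFn : List Bool → List Bool := revMapFn norm ∘ revMapFn norm

/-- `normListFn ∈ FP`. [folklore] -/
theorem normListFn_mem_FP : normListFn ∈ FP :=
  comp_mem_FP (revMapFn_mem_FP norm_mem_FP length_norm_le) (revMapFn_mem_FP norm_mem_FP length_norm_le)

/-- Value of `normListFn`. [folklore] -/
theorem normListFn_apply (L : List Bool) : normListFn L = encList ((decNil L).map norm) := by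
  rw [normListFn, Function.comp_apply, revMapFn_apply, revMapFn_apply, decNil_encList, List.map_reverse,
    List.reverse_reverse, List.map_map]
  exact congrArg encList (List.map_congr_left fun a _ => by simp [norm_eq_encodeNat])

/-- `normListFn` fixes coded factor lists. [folklore] -/
@[simp] theorem normListFn_encFactors (F : List ℕ) : normListFn (encFactors F) = encFactors F := by
  rw [normListFn_apply, decNil_encFactors, List.map_map, encFactors]
  exact congrArg encList (List.map_congr_left fun q _ => by simp [norm_eq_encodeNat])

/-- **The canonical form of an item**: `a ↦ ⟨norm (fstF a), normListFn (sndF a)⟩`. [folklore] -/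
noncomputable def canonItemT : List Bool → List Bool := fanoutFn (norm ∘ fstF) (normListFn ∘ sndF)

/-- `canonItemT ∈ FP`. [folklore] -/
theorem canonItemT_mem_FP : canonItemT ∈ FP :=
  fanoutFn_mem_FP (comp_mem_FP norm_mem_FP fstF_mem_FP) (comp_mem_FP normListFn_mem_FP sndF_mem_FP)

/-- Value of `canonItemT`: the code of the item read off `a`. [folklore] -/
theorem canonItemT_apply (a : List Bool) :
    canonItemT a = encItem (bitsToNat (fstF a), (decNil (sndF a)).map bitsToNat) := by
  simp only [canonItemT, fanoutFn_apply, Function.comp_apply, norm_eq_encodeNat, normListFn_apply, encItem,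
    encFactors, List.map_map]
  congr 1
  exact congrArg encList (List.map_congr_left fun b _ => by simp [norm_eq_encodeNat])

/-- Coded items are canonical. [folklore] -/
@[simp] theorem canonItemT_encItem (rF : ℕ × List ℕ) : canonItemT (encItem rF) = encItem rF := by
  rw [canonItemT_apply, fstF_encItem, sndF_encItem, bitsToNat_encodeNat, decNil_encFactors, List.map_map]
  have : (bitsToNat ∘ encodeNat) = id := funext fun n => bitsToNat_encodeNat n
  rw [this, List.map_id]

/-- **Canonical strings are exactly the codes of item lists.** [folklore] -/
theorem canonical_iff (y : List Bool) :
    (y = relistFn y ∧ ∀ a ∈ decNil y, a = canonItemT a) ↔ ∃ l : List (ℕ × List ℕ), y = encItemsT l := by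
  constructor
  · rintro ⟨hy, hitems⟩
    refine ⟨(decNil y).map fun a => (bitsToNat (fstF a), (decNil (sndF a)).map bitsToNat), ?_⟩
    rw [encItemsT, List.map_map]
    calc y = relistFn y := hy
      _ = encList (decNil y) := relistFn_apply y
      _ = _ := congrArg encList ?_
    conv_lhs => rw [← List.map_id (decNil y)]
    exact List.map_congr_left fun a ha => by rw [id, Function.comp_apply, ← canonItemT_apply]; exact hitems a ha
  · rintro ⟨l, rfl⟩
    refine ⟨?_, fun a ha => ?_⟩
    · rw [relistFn_apply, decNil_encItemsT, encItemsT]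
    · rw [decNil_encItemsT] at ha
      obtain ⟨rF, -, rfl⟩ := List.mem_map.1 ha
      exact (canonItemT_encItem rF).symm

/-! ### The bricks of the verifier -/

section Bricks

variable (T : List Bool → List Bool)

/-- `key ≤ ⟦x⟧` on `z = ⟨⟨x, y⟩, a⟩`. [folklore] -/
noncomputable def keyLeFn : List Bool → List Bool := notFn (ltFn ∘ fanoutFn (fstF ∘ fstF) (fstF ∘ sndF))

/-- `keyLeFn ∈ FP`. [folklore] -/
theorem keyLeFn_mem_FP : keyLeFn ∈ FP :=
  notFn_mem_FP (comp_mem_FP ltFn_mem_FP (fanoutFn_mem_FP (comp_mem_FP fstF_mem_FP fstF_mem_FP) (comp_mem_FP fstF_mem_FP sndF_mem_FP)))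

/-- `keyLeFn` is one-bit. [folklore] -/
theorem oneBit_keyLeFn : OneBit keyLeFn := oneBit_notFn (oneBit_ltFn.comp _)

/-- Truth of `keyLeFn`. [folklore] -/
theorem keyLeFn_eq_true_iff (x y a : List Bool) :
    keyLeFn (boolPair (boolPair x y) a) = [true] ↔ bitsToNat (fstF a) ≤ bitsToNat x := by
  rw [keyLeFn, notFn_eq_true_iff (oneBit_ltFn.comp _)]
  simp only [Function.comp_apply, fanoutFn_apply, fstF_boolPair, sndF_boolPair, ltFn_boolPair, List.singleton_inj,
    decide_eq_true_eq, not_lt]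

/-- `⟦b⟧ ≤ ⟦b'⟧` on `⟨ctx, ⟨b, b'⟩⟩` (consecutive numerals do not decrease). [folklore] -/
noncomputable def leValFn : List Bool → List Bool := notFn (ltFn ∘ fanoutFn (sndF ∘ sndF) (fstF ∘ sndF))

/-- `leValFn ∈ FP`. [folklore] -/
theorem leValFn_mem_FP : leValFn ∈ FP :=
  notFn_mem_FP (comp_mem_FP ltFn_mem_FP (fanoutFn_mem_FP (comp_mem_FP sndF_mem_FP sndF_mem_FP) (comp_mem_FP fstF_mem_FP sndF_mem_FP)))

/-- `leValFn` is one-bit. [folklore] -/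
theorem oneBit_leValFn : OneBit leValFn := oneBit_notFn (oneBit_ltFn.comp _)

/-- Truth of `leValFn`. [folklore] -/
theorem leValFn_eq_true_iff (ctx b b' : List Bool) :
    leValFn (boolPair ctx (boolPair b b')) = [true] ↔ bitsToNat b ≤ bitsToNat b' := by
  rw [leValFn, notFn_eq_true_iff (oneBit_ltFn.comp _)]
  simp only [Function.comp_apply, fanoutFn_apply, fstF_boolPair, sndF_boolPair, ltFn_boolPair, List.singleton_inj,
    decide_eq_true_eq, not_lt]

/-- `∏ F = key − 1` on `z = ⟨w, a⟩`, `a = ⟨key, F⟩`. [folklore] -/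
noncomputable def prodOkFn : List Bool → List Bool :=
  eqValFn ∘ fanoutFn (prodListFn ∘ fanoutFn id (sndF ∘ sndF)) (subFn ∘ fanoutFn (fstF ∘ sndF) (fun _ => [true]))

/-- `prodOkFn ∈ FP`. [folklore] -/
theorem prodOkFn_mem_FP : prodOkFn ∈ FP :=
  comp_mem_FP eqValFn_mem_FP (fanoutFn_mem_FP
    (comp_mem_FP prodListFn_mem_FP (fanoutFn_mem_FP (PolyTimeComputable.id _) (comp_mem_FP sndF_mem_FP sndF_mem_FP)))
    (comp_mem_FP subFn_mem_FP (fanoutFn_mem_FP (comp_mem_FP fstF_mem_FP sndF_mem_FP) (const_mem_FP _))))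

/-- `prodOkFn` is one-bit. [folklore] -/
theorem oneBit_prodOkFn : OneBit prodOkFn := oneBit_eqValFn.comp _

/-- Truth of `prodOkFn`. [folklore] -/
theorem prodOkFn_eq_true_iff (w a : List Bool) :
    prodOkFn (boolPair w a) = [true] ↔ ((decNil (sndF a)).map bitsToNat).prod = bitsToNat (fstF a) - 1 := by
  simp only [prodOkFn, Function.comp_apply, fanoutFn_apply, id, sndF_boolPair, prodListFn_boolPair,
    subFn_boolPair, eqValFn_boolPair, bitsToNat_encodeNat, List.singleton_inj, decide_eq_true_eq]
  rfl

/-- `f` is a key of `y`, on `⟨⟨w, a⟩, f⟩` with `w = ⟨x, y⟩`. [folklore] -/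
noncomputable def keyMemFn : List Bool → List Bool := memHeadFn ∘ fanoutFn sndF (sndF ∘ fstF ∘ fstF)

/-- `keyMemFn ∈ FP`. [folklore] -/
theorem keyMemFn_mem_FP : keyMemFn ∈ FP :=
  comp_mem_FP memHeadFn_mem_FP (fanoutFn_mem_FP sndF_mem_FP (comp_mem_FP sndF_mem_FP (comp_mem_FP fstF_mem_FP fstF_mem_FP)))

/-- `keyMemFn` is one-bit. [folklore] -/
theorem oneBit_keyMemFn : OneBit keyMemFn := oneBit_memHeadFn.comp _

/-- Truth of `keyMemFn`. [folklore] -/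
theorem keyMemFn_eq_true_iff (x y a f : List Bool) :
    keyMemFn (boolPair (boolPair (boolPair x y) a) f) = [true] ↔
      ∃ item ∈ decNil y, bitsToNat (fstF item) = bitsToNat f := by
  simp only [keyMemFn, Function.comp_apply, fanoutFn_apply, sndF_boolPair, fstF_boolPair,
    PrattMachine.memHeadFn_eq_true_iff]

/-- **The item test** on `z = ⟨w, a⟩`, `w = ⟨x, y⟩`, `a = ⟨key, F⟩`: `2 ≤ key ≤ ⟦x⟧`, `F` is sorted with
product `key − 1`, every member of `F` is a key of `y`, and the test `T` accepts `a`.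
[cite: FellowsKoblitz1992, §2 (proof of Thm. 1)] -/
noncomputable def itemTestFn : List Bool → List Bool :=
  andFn (valGeTwoFn ∘ fstF ∘ sndF)
    (andFn keyLeFn
      (andFn (chainFn leValFn ∘ fanoutFn id (sndF ∘ sndF))
        (andFn prodOkFn
          (andFn (allFn keyMemFn ∘ fanoutFn id (sndF ∘ sndF)) (T ∘ sndF)))))

variable {T}

/-- `itemTestFn T ∈ FP` for `T ∈ FP`. [cite: AroraBarakCC2009, §1.3] -/
theorem itemTestFn_mem_FP (hT : T ∈ FP) : itemTestFn T ∈ FP :=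
  andFn_mem_FP (comp_mem_FP valGeTwoFn_mem_FP (comp_mem_FP fstF_mem_FP sndF_mem_FP))
    (andFn_mem_FP keyLeFn_mem_FP
      (andFn_mem_FP (comp_mem_FP (chainFn_mem_FP leValFn_mem_FP oneBit_leValFn)
          (fanoutFn_mem_FP (PolyTimeComputable.id _) (comp_mem_FP sndF_mem_FP sndF_mem_FP)))
        (andFn_mem_FP prodOkFn_mem_FP
          (andFn_mem_FP (comp_mem_FP (allFn_mem_FP keyMemFn_mem_FP oneBit_keyMemFn)
              (fanoutFn_mem_FP (PolyTimeComputable.id _) (comp_mem_FP sndF_mem_FP sndF_mem_FP)))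
            (comp_mem_FP hT sndF_mem_FP)))))

/-- `itemTestFn T` is one-bit for a one-bit `T`. [folklore] -/
theorem oneBit_itemTestFn (hT : OneBit T) : OneBit (itemTestFn T) :=
  oneBit_andFn (oneBit_valGeTwoFn.comp _) (oneBit_andFn oneBit_keyLeFn (oneBit_andFn ((oneBit_chainFn _).comp _)
    (oneBit_andFn oneBit_prodOkFn (oneBit_andFn ((oneBit_allFn oneBit_keyMemFn).comp _) (hT.comp _)))))

/-- **Truth of the item test on a coded item.** [cite: FellowsKoblitz1992, §2 (proof of Thm. 1)] -/
theorem itemTestFn_encItem_iff (hT : OneBit T) (x : List Bool) (l : List (ℕ × List ℕ)) (r : ℕ) (F : List ℕ) :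
    itemTestFn T (boolPair (boolPair x (encItemsT l)) (encItem (r, F))) = [true] ↔
      2 ≤ r ∧ r ≤ bitsToNat x ∧ F.SortedLE ∧ F.prod = r - 1 ∧ (∀ f ∈ F, ∃ rF ∈ l, rF.1 = f) ∧
        T (encItem (r, F)) = [true] := by
  rw [itemTestFn, andFn_eq_true_iff (oneBit_valGeTwoFn.comp _) (oneBit_andFn oneBit_keyLeFn (oneBit_andFn
      ((oneBit_chainFn _).comp _) (oneBit_andFn oneBit_prodOkFn (oneBit_andFn ((oneBit_allFn oneBit_keyMemFn).comp _)
      (hT.comp _))))),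
    andFn_eq_true_iff oneBit_keyLeFn (oneBit_andFn ((oneBit_chainFn _).comp _) (oneBit_andFn oneBit_prodOkFn
      (oneBit_andFn ((oneBit_allFn oneBit_keyMemFn).comp _) (hT.comp _)))),
    andFn_eq_true_iff ((oneBit_chainFn _).comp _) (oneBit_andFn oneBit_prodOkFn
      (oneBit_andFn ((oneBit_allFn oneBit_keyMemFn).comp _) (hT.comp _))),
    andFn_eq_true_iff oneBit_prodOkFn (oneBit_andFn ((oneBit_allFn oneBit_keyMemFn).comp _) (hT.comp _)),
    andFn_eq_true_iff ((oneBit_allFn oneBit_keyMemFn).comp _) (hT.comp _),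
    keyLeFn_eq_true_iff, prodOkFn_eq_true_iff]
  have hchain : (chainFn leValFn ∘ fanoutFn id (sndF ∘ sndF)) (boolPair (boolPair x (encItemsT l)) (encItem (r, F))) = [true] ↔
      F.SortedLE := by
    simp only [Function.comp_apply, fanoutFn_apply, id, sndF_boolPair, sndF_encItem, encFactors]
    rw [chainFn_encList_eq_true oneBit_leValFn, List.isChain_map, List.sortedLE_iff_isChain]
    simp only [leValFn_eq_true_iff, bitsToNat_encodeNat]
  have hkeys : (allFn keyMemFn ∘ fanoutFn id (sndF ∘ sndF)) (boolPair (boolPair x (encItemsT l)) (encItem (r, F))) = [true] ↔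
      ∀ f ∈ F, ∃ rF ∈ l, rF.1 = f := by
    simp only [Function.comp_apply, fanoutFn_apply, id, sndF_boolPair, sndF_encItem]
    rw [allFn_boolPair_eq_true oneBit_keyMemFn, decNil_encFactors, List.forall_mem_map]
    simp only [keyMemFn_eq_true_iff, decNil_encItemsT, List.mem_map, exists_exists_and_eq_and, fstF_encItem, bitsToNat_encodeNat]
  have hprod : ((decNil (sndF (encItem (r, F)))).map bitsToNat) = F := by
    rw [sndF_encItem, decNil_encFactors, List.map_map]
    have : (bitsToNat ∘ encodeNat) = id := funext fun n => bitsToNat_encodeNat n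
    rw [this, List.map_id]
  rw [hchain, hkeys, hprod]
  simp only [Function.comp_apply, sndF_boolPair, fstF_encItem, bitsToNat_encodeNat, valGeTwoFn, List.singleton_inj,
    decide_eq_true_eq]

/-- `∃ f ∈ F_b, ⟦key a⟧ = ⟦f⟧` on `⟨⟨w, a⟩, b⟩`: the key of `a` divides `key b − 1` according to item `b`.
[folklore] -/
noncomputable def parentFn : List Bool → List Bool := anyFn eqValFn ∘ fanoutFn (fstF ∘ sndF ∘ fstF) (sndF ∘ sndF)

/-- `parentFn ∈ FP`. [folklore] -/
theorem parentFn_mem_FP : parentFn ∈ FP :=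
  comp_mem_FP (anyFn_mem_FP eqValFn_mem_FP oneBit_eqValFn)
    (fanoutFn_mem_FP (comp_mem_FP fstF_mem_FP (comp_mem_FP sndF_mem_FP fstF_mem_FP)) (comp_mem_FP sndF_mem_FP sndF_mem_FP))

/-- `parentFn` is one-bit. [folklore] -/
theorem oneBit_parentFn : OneBit parentFn := (oneBit_anyFn oneBit_eqValFn).comp _

/-- Truth of `parentFn`. [folklore] -/
theorem parentFn_eq_true_iff (w a b : List Bool) :
    parentFn (boolPair (boolPair w a) b) = [true] ↔ ∃ f ∈ decNil (sndF b), bitsToNat (fstF a) = bitsToNat f := by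
  simp only [parentFn, Function.comp_apply, fanoutFn_apply, fstF_boolPair, sndF_boolPair]
  rw [anyFn_boolPair_eq_true oneBit_eqValFn]
  simp only [eqValFn_boolPair, List.singleton_inj, decide_eq_true_eq]

/-- **The minimality test** on `z = ⟨w, a⟩`: the key of `a` is `⟦x⟧`, or divides `key b − 1` for some
item `b` of `y`. [cite: FellowsKoblitz1992, §2 (proof of Thm. 1)] -/
noncomputable def minFn : List Bool → List Bool :=
  orFn (eqValFn ∘ fanoutFn (fstF ∘ sndF) (fstF ∘ fstF)) (anyFn parentFn ∘ fanoutFn id (sndF ∘ fstF))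

/-- `minFn ∈ FP`. [folklore] -/
theorem minFn_mem_FP : minFn ∈ FP :=
  orFn_mem_FP (comp_mem_FP eqValFn_mem_FP (fanoutFn_mem_FP (comp_mem_FP fstF_mem_FP sndF_mem_FP) (comp_mem_FP fstF_mem_FP fstF_mem_FP)))
    (comp_mem_FP (anyFn_mem_FP parentFn_mem_FP oneBit_parentFn)
      (fanoutFn_mem_FP (PolyTimeComputable.id _) (comp_mem_FP sndF_mem_FP fstF_mem_FP)))

/-- `minFn` is one-bit. [folklore] -/
theorem oneBit_minFn : OneBit minFn := oneBit_orFn (oneBit_eqValFn.comp _) ((oneBit_anyFn oneBit_parentFn).comp _)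

/-- **Truth of the minimality test on a coded item.** [cite: FellowsKoblitz1992, §2 (proof of Thm. 1)] -/
theorem minFn_encItem_iff (x : List Bool) (l : List (ℕ × List ℕ)) (rF : ℕ × List ℕ) :
    minFn (boolPair (boolPair x (encItemsT l)) (encItem rF)) = [true] ↔
      rF.1 = bitsToNat x ∨ ∃ rF' ∈ l, rF.1 ∈ rF'.2 := by
  rw [minFn, orFn_eq_true_iff (oneBit_eqValFn.comp _) ((oneBit_anyFn oneBit_parentFn).comp _)]
  have h2 : (anyFn parentFn ∘ fanoutFn id (sndF ∘ fstF)) (boolPair (boolPair x (encItemsT l)) (encItem rF)) = [true] ↔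
      ∃ rF' ∈ l, rF.1 ∈ rF'.2 := by
    simp only [Function.comp_apply, fanoutFn_apply, id, fstF_boolPair, sndF_boolPair]
    rw [anyFn_boolPair_eq_true oneBit_parentFn, decNil_encItemsT]
    simp only [List.mem_map, exists_exists_and_eq_and, parentFn_eq_true_iff, fstF_encItem, sndF_encItem,
      decNil_encFactors, bitsToNat_encodeNat, exists_eq_right']
  rw [h2]
  simp only [Function.comp_apply, fanoutFn_apply, fstF_boolPair, sndF_boolPair, fstF_encItem, eqValFn_boolPair,
    bitsToNat_encodeNat, List.singleton_inj, decide_eq_true_eq]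

/-- `key a < key b` on `⟨x, ⟨a, b⟩⟩` (keys strictly increase). [folklore] -/
noncomputable def ltKeyFn : List Bool → List Bool := ltFn ∘ fanoutFn (fstF ∘ fstF ∘ sndF) (fstF ∘ sndF ∘ sndF)

/-- `ltKeyFn ∈ FP`. [folklore] -/
theorem ltKeyFn_mem_FP : ltKeyFn ∈ FP :=
  comp_mem_FP ltFn_mem_FP (fanoutFn_mem_FP (comp_mem_FP fstF_mem_FP (comp_mem_FP fstF_mem_FP sndF_mem_FP))
    (comp_mem_FP fstF_mem_FP (comp_mem_FP sndF_mem_FP sndF_mem_FP)))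

/-- `ltKeyFn` is one-bit. [folklore] -/
theorem oneBit_ltKeyFn : OneBit ltKeyFn := oneBit_ltFn.comp _

/-- Truth of `ltKeyFn`. [folklore] -/
theorem ltKeyFn_eq_true_iff (x a b : List Bool) :
    ltKeyFn (boolPair x (boolPair a b)) = [true] ↔ bitsToNat (fstF a) < bitsToNat (fstF b) := by
  simp only [ltKeyFn, Function.comp_apply, fanoutFn_apply, fstF_boolPair, sndF_boolPair, ltFn_boolPair,
    List.singleton_inj, decide_eq_true_eq]

variable (T)

/-- **The tree test** on `w = ⟨x, y⟩`: keys strictly increasing, `⟦x⟧` a key, every item passes the item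
test, every item passes the minimality test. [cite: FellowsKoblitz1992, §2 (proof of Thm. 1)] -/
noncomputable def treeFn : List Bool → List Bool :=
  andFn (chainFn ltKeyFn) (andFn memHeadFn
    (andFn (allFn (itemTestFn T) ∘ fanoutFn id sndF) (allFn minFn ∘ fanoutFn id sndF)))

/-- **The structure test** on `w = ⟨x, y⟩`: `x` is a canonical numeral and `y` is canonically coded.
[folklore] -/
noncomputable def structFn : List Bool → List Bool :=
  andFn (eqPairFn ∘ fanoutFn fstF (norm ∘ fstF))
    (andFn (eqPairFn ∘ fanoutFn sndF (relistFn ∘ sndF)) (allFn (eqPairFn ∘ fanoutFn sndF (canonItemT ∘ sndF))))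

/-- **The verifier of primality** `primesUpFn T = structFn ∧ treeFn T`. [cite: FellowsKoblitz1992, §2 (proof of Thm. 1)] -/
noncomputable def primesUpFn : List Bool → List Bool := andFn structFn (treeFn T)

variable {T}

/-- `treeFn T ∈ FP` for `T ∈ FP` one-bit. [cite: AroraBarakCC2009, §1.3] -/
theorem treeFn_mem_FP (hT : T ∈ FP) (h1 : OneBit T) : treeFn T ∈ FP :=
  andFn_mem_FP (chainFn_mem_FP ltKeyFn_mem_FP oneBit_ltKeyFn) (andFn_mem_FP memHeadFn_mem_FP
    (andFn_mem_FP (comp_mem_FP (allFn_mem_FP (itemTestFn_mem_FP hT) (oneBit_itemTestFn h1))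
        (fanoutFn_mem_FP (PolyTimeComputable.id _) sndF_mem_FP))
      (comp_mem_FP (allFn_mem_FP minFn_mem_FP oneBit_minFn) (fanoutFn_mem_FP (PolyTimeComputable.id _) sndF_mem_FP))))

/-- `treeFn T` is one-bit. [folklore] -/
theorem oneBit_treeFn (h1 : OneBit T) : OneBit (treeFn T) :=
  oneBit_andFn (oneBit_chainFn _) (oneBit_andFn oneBit_memHeadFn
    (oneBit_andFn ((oneBit_allFn (oneBit_itemTestFn h1)).comp _) ((oneBit_allFn oneBit_minFn).comp _)))

/-- `structFn ∈ FP`. [folklore] -/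
theorem structFn_mem_FP : structFn ∈ FP :=
  andFn_mem_FP (comp_mem_FP eqPairFn_mem_FP (fanoutFn_mem_FP fstF_mem_FP (comp_mem_FP norm_mem_FP fstF_mem_FP)))
    (andFn_mem_FP (comp_mem_FP eqPairFn_mem_FP (fanoutFn_mem_FP sndF_mem_FP (comp_mem_FP relistFn_mem_FP sndF_mem_FP)))
      (allFn_mem_FP (comp_mem_FP eqPairFn_mem_FP (fanoutFn_mem_FP sndF_mem_FP (comp_mem_FP canonItemT_mem_FP sndF_mem_FP)))
        (oneBit_eqPairFn.comp _)))

/-- `structFn` is one-bit. [folklore] -/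
theorem oneBit_structFn : OneBit structFn :=
  oneBit_andFn (oneBit_eqPairFn.comp _) (oneBit_andFn (oneBit_eqPairFn.comp _) (oneBit_allFn (oneBit_eqPairFn.comp _)))

/-- `primesUpFn T ∈ FP`. [cite: AroraBarakCC2009, §1.3] -/
theorem primesUpFn_mem_FP (hT : T ∈ FP) (h1 : OneBit T) : primesUpFn T ∈ FP :=
  andFn_mem_FP structFn_mem_FP (treeFn_mem_FP hT h1)

/-- `primesUpFn T` is one-bit. [folklore] -/
theorem oneBit_primesUpFn (h1 : OneBit T) : OneBit (primesUpFn T) := oneBit_andFn oneBit_structFn (oneBit_treeFn h1)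

/-- **Truth of the structure test**: `x` is canonical and `y` codes a list of items. [folklore] -/
theorem structFn_eq_true_iff (x y : List Bool) :
    structFn (boolPair x y) = [true] ↔ x = encodeNat (bitsToNat x) ∧ ∃ l : List (ℕ × List ℕ), y = encItemsT l := by
  rw [structFn, andFn_eq_true_iff (oneBit_eqPairFn.comp _) (oneBit_andFn (oneBit_eqPairFn.comp _) (oneBit_allFn (oneBit_eqPairFn.comp _))),
    andFn_eq_true_iff (oneBit_eqPairFn.comp _) (oneBit_allFn (oneBit_eqPairFn.comp _)),
    allFn_boolPair_eq_true (oneBit_eqPairFn.comp _), ← canonical_iff]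
  simp only [Function.comp_apply, fanoutFn_apply, fstF_boolPair, sndF_boolPair, eqPairFn_boolPair_eq_true, norm_eq_encodeNat]

/-- **Truth of the tree test on the code of a list of items.** [cite: FellowsKoblitz1992, §2 (proof of Thm. 1)] -/
theorem treeFn_encItemsT_iff (h1 : OneBit T) (x : List Bool) (l : List (ℕ × List ℕ)) :
    treeFn T (boolPair x (encItemsT l)) = [true] ↔
      (l.map Prod.fst).SortedLT ∧ (∃ rF ∈ l, rF.1 = bitsToNat x) ∧
        (∀ rF ∈ l, 2 ≤ rF.1 ∧ rF.1 ≤ bitsToNat x ∧ rF.2.SortedLE ∧ rF.2.prod = rF.1 - 1 ∧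
          (∀ f ∈ rF.2, ∃ rF' ∈ l, rF'.1 = f) ∧ T (encItem rF) = [true]) ∧
        (∀ rF ∈ l, rF.1 = bitsToNat x ∨ ∃ rF' ∈ l, rF.1 ∈ rF'.2) := by
  rw [treeFn, andFn_eq_true_iff (oneBit_chainFn _) (oneBit_andFn oneBit_memHeadFn (oneBit_andFn
      ((oneBit_allFn (oneBit_itemTestFn h1)).comp _) ((oneBit_allFn oneBit_minFn).comp _))),
    andFn_eq_true_iff oneBit_memHeadFn (oneBit_andFn ((oneBit_allFn (oneBit_itemTestFn h1)).comp _) ((oneBit_allFn oneBit_minFn).comp _)),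
    andFn_eq_true_iff ((oneBit_allFn (oneBit_itemTestFn h1)).comp _) ((oneBit_allFn oneBit_minFn).comp _)]
  have hchain : chainFn ltKeyFn (boolPair x (encItemsT l)) = [true] ↔ (l.map Prod.fst).SortedLT := by
    rw [encItemsT, chainFn_encList_eq_true oneBit_ltKeyFn, List.sortedLT_iff_isChain, List.isChain_map, List.isChain_map]
    simp only [ltKeyFn_eq_true_iff, fstF_encItem, bitsToNat_encodeNat]
  have hhead : memHeadFn (boolPair x (encItemsT l)) = [true] ↔ ∃ rF ∈ l, rF.1 = bitsToNat x := by
    rw [PrattMachine.memHeadFn_eq_true_iff, decNil_encItemsT]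
    simp only [List.mem_map, exists_exists_and_eq_and, fstF_encItem, bitsToNat_encodeNat]
  have hitems : (allFn (itemTestFn T) ∘ fanoutFn id sndF) (boolPair x (encItemsT l)) = [true] ↔
      ∀ rF ∈ l, 2 ≤ rF.1 ∧ rF.1 ≤ bitsToNat x ∧ rF.2.SortedLE ∧ rF.2.prod = rF.1 - 1 ∧
        (∀ f ∈ rF.2, ∃ rF' ∈ l, rF'.1 = f) ∧ T (encItem rF) = [true] := by
    simp only [Function.comp_apply, fanoutFn_apply, id, sndF_boolPair]
    rw [allFn_boolPair_eq_true (oneBit_itemTestFn h1), decNil_encItemsT, List.forall_mem_map]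
    exact forall₂_congr fun rF _ => itemTestFn_encItem_iff h1 x l rF.1 rF.2
  have hmin : (allFn minFn ∘ fanoutFn id sndF) (boolPair x (encItemsT l)) = [true] ↔
      ∀ rF ∈ l, rF.1 = bitsToNat x ∨ ∃ rF' ∈ l, rF.1 ∈ rF'.2 := by
    simp only [Function.comp_apply, fanoutFn_apply, id, sndF_boolPair]
    rw [allFn_boolPair_eq_true oneBit_minFn, decNil_encItemsT, List.forall_mem_map]
    exact forall₂_congr fun rF _ => minFn_encItem_iff x l rF
  rw [hchain, hhead, hitems, hmin]

/-- **Truth of the verifier.** [cite: FellowsKoblitz1992, §2 (proof of Thm. 1)] -/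
theorem primesUpFn_eq_true_iff (h1 : OneBit T) (x y : List Bool) :
    primesUpFn T (boolPair x y) = [true] ↔
      x = encodeNat (bitsToNat x) ∧ ∃ l : List (ℕ × List ℕ), y = encItemsT l ∧ treeFn T (boolPair x (encItemsT l)) = [true] := by
  rw [primesUpFn, andFn_eq_true_iff oneBit_structFn (oneBit_treeFn h1), structFn_eq_true_iff]
  constructor
  · rintro ⟨⟨hx, l, rfl⟩, ht⟩
    exact ⟨hx, l, rfl, ht⟩
  · rintro ⟨hx, l, rfl, ht⟩
    exact ⟨⟨hx, l, rfl⟩, ht⟩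

end Bricks

end PrimesUP

/-! ### The hypothesis: a polynomial-time test for factored `p − 1` -/

/-- `IsFactoredPrimalityTest T`: the brick `T ∈ FP` answers one bit, and on
`⟨encodeNat p, encList (primeFactorsList (p − 1))⟩`, `p ≥ 2`, that bit is `[p is prime]` — a
deterministic polynomial-time primality test for numbers given with the prime factorisation of `p − 1`
(Fellows–Koblitz 1992, Lemma 1, in machine form; also any primality test in `P`, ignoring the list).
[cite: FellowsKoblitz1992, §2 (Lemma 1)] -/
structure IsFactoredPrimalityTest (T : List Bool → List Bool) : Prop where
  /-- the test is polynomial-time -/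
  mem_FP : T ∈ FP
  /-- the test answers one bit on every input -/
  oneBit : OneBit T
  /-- on a number `p ≥ 2` with the prime factorisation of `p − 1`, the answer is `[p is prime]` -/
  correct : ∀ p : ℕ, 2 ≤ p →
    T (boolPair (encodeNat p) (encList (((p - 1).primeFactorsList).map encodeNat))) = [decide p.Prime]

/-! ### Soundness with uniqueness, completeness, succinctness -/

namespace PrimesUP

section Analysis

variable {T : List Bool → List Bool}

/-- The test on a coded item with the true factorisation. [folklore] -/
theorem test_encItem (hT : IsFactoredPrimalityTest T) {r : ℕ} (hr : 2 ≤ r) :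
    T (encItem (r, (r - 1).primeFactorsList)) = [decide r.Prime] :=
  hT.correct r hr

/-- **Soundness of the item tests**: if every item of `l` passes, then every key is prime and carries
the prime factorisation of `key − 1` (strong induction on the key: the members of `F` are smaller keys).
[cite: FellowsKoblitz1992, §2 (proof of Thm. 1)] -/
theorem prime_and_eq_of_items (hT : IsFactoredPrimalityTest T) {l : List (ℕ × List ℕ)}
    (hitems : ∀ rF ∈ l, 2 ≤ rF.1 ∧ rF.2.SortedLE ∧ rF.2.prod = rF.1 - 1 ∧
      (∀ f ∈ rF.2, ∃ rF' ∈ l, rF'.1 = f) ∧ T (encItem rF) = [true]) :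
    ∀ rF ∈ l, rF.1.Prime ∧ rF.2 = (rF.1 - 1).primeFactorsList := by
  suffices key : ∀ n, ∀ rF ∈ l, rF.1 < n → rF.1.Prime ∧ rF.2 = (rF.1 - 1).primeFactorsList from
    fun rF hrF => key _ rF hrF (Nat.lt_succ_self _)
  intro n
  induction n with
  | zero => intro rF _ h; omega
  | succ n ih =>
    intro rF hrF hlt
    obtain ⟨h2, hsorted, hprod, hkeys, htest⟩ := hitems rF hrF
    -- the members of `F` are primes (smaller keys)
    have hF : ∀ f ∈ rF.2, f.Prime := by
      intro f hf
      obtain ⟨rF', hrF', rfl⟩ := hkeys f hf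
      have h2' := (hitems rF' hrF').1
      have hdvd : rF'.1 ∣ rF.1 - 1 := hprod ▸ List.dvd_prod hf
      have hle : rF'.1 ≤ rF.1 - 1 := Nat.le_of_dvd (by omega) hdvd
      exact (ih rF' hrF' (by omega)).1
    have hperm := Nat.primeFactorsList_unique hprod hF
    have hFeq : rF.2 = (rF.1 - 1).primeFactorsList := hperm.eq_of_sortedLE hsorted (Nat.primeFactorsList_sorted _)
    refine ⟨?_, hFeq⟩
    have ht : T (encItem (rF.1, (rF.1 - 1).primeFactorsList)) = [true] := by rw [← hFeq]; exact htest
    rw [test_encItem hT h2] at ht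
    simpa using ht

/-- **Soundness and uniqueness**: if the verifier accepts `⟨x, y⟩` then `x = encodeNat p` with `p` prime
and `y = primesWit p`. [cite: FellowsKoblitz1992, §2 (proof of Thm. 1)] -/
theorem eq_primesWit_of_primesUpFn (hT : IsFactoredPrimalityTest T) {x y : List Bool}
    (h : primesUpFn T (boolPair x y) = [true]) :
    x = encodeNat (bitsToNat x) ∧ (bitsToNat x).Prime ∧ y = primesWit (bitsToNat x) := by
  obtain ⟨hx, l, rfl, ht⟩ := (primesUpFn_eq_true_iff hT.oneBit x y).1 h
  obtain ⟨hsorted, ⟨rF₀, hrF₀, hrF₀x⟩, hitems, hmin⟩ := (treeFn_encItemsT_iff hT.oneBit x l).1 ht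
  set p := bitsToNat x with hp
  have hall := prime_and_eq_of_items hT fun rF hrF =>
    ⟨(hitems rF hrF).1, (hitems rF hrF).2.2.1, (hitems rF hrF).2.2.2.1, (hitems rF hrF).2.2.2.2.1, (hitems rF hrF).2.2.2.2.2⟩
  have hpprime : p.Prime := hrF₀x ▸ (hall rF₀ hrF₀).1
  refine ⟨hx, hpprime, ?_⟩
  -- the keys form `treeSet p`
  set keys := l.map Prod.fst with hkeys
  have hmemkeys : ∀ r, r ∈ keys ↔ ∃ rF ∈ l, rF.1 = r := fun r => by simp [hkeys]
  have hK : keys.toFinset = treeSet p := by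
    refine eq_treeSet hpprime.pos ?_ ?_ ?_ ?_
    · exact List.mem_toFinset.2 ((hmemkeys p).2 ⟨rF₀, hrF₀, hrF₀x⟩)
    · intro r hr q hq
      obtain ⟨rF, hrF, rfl⟩ := (hmemkeys r).1 (List.mem_toFinset.1 hr)
      rw [← (hall rF hrF).2] at hq
      obtain ⟨rF', hrF', hrF'q⟩ := (hitems rF hrF).2.2.2.2.1 q hq
      exact List.mem_toFinset.2 ((hmemkeys q).2 ⟨rF', hrF', hrF'q⟩)
    · intro r hr
      obtain ⟨rF, hrF, rfl⟩ := (hmemkeys r).1 (List.mem_toFinset.1 hr)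
      exact (hitems rF hrF).2.1
    · intro r hr
      obtain ⟨rF, hrF, rfl⟩ := (hmemkeys r).1 (List.mem_toFinset.1 hr)
      rcases hmin rF hrF with h | ⟨rF', hrF', hmem⟩
      · exact Or.inl h
      · refine Or.inr ⟨rF'.1, List.mem_toFinset.2 ((hmemkeys _).2 ⟨rF', hrF', rfl⟩), ?_⟩
        rw [← (hall rF' hrF').2]
        exact hmem
  -- hence the keys are `treeList p` and the items are determined
  have hkeysEq : keys = treeList p := by
    have hnd : keys.Nodup := hsorted.nodup
    have hperm : keys.Perm (treeList p) :=
      List.perm_of_nodup_nodup_toFinset_eq hnd (Finset.sort_nodup (treeSet p) fun a b => a ≤ b)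
        (by rw [hK, treeList, Finset.sort_toFinset])
    exact hperm.eq_of_sortedLE hsorted.sortedLE (Finset.sortedLT_sort _).sortedLE
  have hl : l = keys.map fun r => (r, (r - 1).primeFactorsList) := by
    rw [hkeys, List.map_map]
    conv_lhs => rw [← List.map_id l]
    refine List.map_congr_left fun rF hrF => ?_
    simp only [Function.comp_apply, id]
    exact Prod.ext rfl (hall rF hrF).2
  rw [primesWit, ← hkeysEq, ← hl]

/-- **Completeness**: the certificate of a prime passes. [cite: FellowsKoblitz1992, §2 (proof of Thm. 1)] -/
theorem primesUpFn_primesWit (hT : IsFactoredPrimalityTest T) {p : ℕ} (hp : p.Prime) :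
    primesUpFn T (boolPair (encodeNat p) (primesWit p)) = [true] := by
  rw [primesUpFn_eq_true_iff hT.oneBit]
  refine ⟨by simp, _, rfl, ?_⟩
  rw [treeFn_encItemsT_iff hT.oneBit]
  have hmem : ∀ r, r ∈ treeList p ↔ r ∈ treeSet p := fun r => by rw [treeList, Finset.mem_sort]
  have hkeys : ((treeList p).map fun r => (r, (r - 1).primeFactorsList)).map Prod.fst = treeList p := by
    rw [List.map_map]; exact List.map_id _
  rw [hkeys]
  simp only [bitsToNat_encodeNat, List.forall_mem_map]
  simp only [List.mem_map, exists_exists_and_eq_and]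
  refine ⟨Finset.sortedLT_sort _, ⟨p, (hmem p).2 (self_mem_treeSet hp.pos), rfl⟩, fun r hr => ?_, fun r hr => ?_⟩
  · have hrT := (hmem r).1 hr
    have hrprime := prime_of_mem_treeSet hp hrT
    refine ⟨hrprime.two_le, (pos_and_le_of_mem_treeSet hp.pos hrT).2, Nat.primeFactorsList_sorted _,
      Nat.prod_primeFactorsList (by have := hrprime.two_le; omega), fun q hq => ?_, ?_⟩
    · exact ⟨q, (hmem q).2 (treeSet_closed hp.pos hrT hq), rfl⟩
    · show T (encItem (r, (r - 1).primeFactorsList)) = [true]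
      rw [test_encItem hT hrprime.two_le]
      simp [hrprime]
  · have hrT := (hmem r).1 hr
    by_cases hrp : r = p
    · exact Or.inl hrp
    · obtain ⟨r', hr', hrr'⟩ := exists_parent_of_mem_treeSet hp.pos hrT hrp
      exact Or.inr ⟨r', (hmem r').2 hr', hrr'⟩

/-- Length of a coded factor list: `Σ (2 size q + 2)`. [folklore] -/
theorem length_encFactors (F : List ℕ) : (encFactors F).length = (F.map fun q => 2 * q.size + 2).sum := by
  rw [encFactors, PrattMachine.length_encList_map_encodeNat]

/-- **Length of a coded item of the certificate**: `|encItem (r, primeFactorsList (r − 1))| ≤ 8 size r + 2`.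
[folklore] -/
theorem length_encItem_le {r : ℕ} (hr : 2 ≤ r) :
    (encItem (r, (r - 1).primeFactorsList)).length ≤ 8 * r.size + 2 := by
  have h0 : r - 1 ≠ 0 := by omega
  have hsz := Pratt.sum_size_primeFactorsList_lt h0
  have hlen := Pratt.length_primeFactorsList_lt_size h0
  have hmono : (r - 1).size ≤ r.size := Nat.size_le_size (Nat.sub_le r 1)
  have hsum : ((r - 1).primeFactorsList.map fun q => 2 * q.size + 2).sum =
      2 * ((r - 1).primeFactorsList.map Nat.size).sum + 2 * (r - 1).primeFactorsList.length := by
    induction (r - 1).primeFactorsList with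
    | nil => simp
    | cons q l ih => simp only [List.map_cons, List.sum_cons, List.length_cons, ih]; ring
  simp only [encItem, length_boolPair, TM2Pass.length_encodeNat_eq_size, length_encFactors, hsum]
  omega

/-- **Succinctness**: `|primesWit p| ≤ 32 size² p + 12 size p` (fewer than `2 size p` items of at most
`8 size p + 2` symbols). [cite: CrandallPomerance1999, Thm 4.1.9] -/
theorem length_primesWit_le {p : ℕ} (hp : p.Prime) : (primesWit p).length ≤ 32 * p.size ^ 2 + 12 * p.size := by
  have hcount : (treeList p).length + 1 < 2 * p.size := by
    rw [treeList, Finset.length_sort]; exact card_treeSet_lt hp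
  have hmem : ∀ r, r ∈ treeList p → r ∈ treeSet p := fun r hr => by rwa [treeList, Finset.mem_sort] at hr
  have hitem : ∀ r ∈ treeList p, 2 * (encItem (r, (r - 1).primeFactorsList)).length + 2 ≤ 16 * p.size + 6 := by
    intro r hr
    have hrT := hmem r hr
    have hrprime := prime_of_mem_treeSet hp hrT
    have h1 := length_encItem_le hrprime.two_le
    have h2 : r.size ≤ p.size := Nat.size_le_size (pos_and_le_of_mem_treeSet hp.pos hrT).2
    omega
  rw [primesWit, encItemsT, length_encList, List.map_map, List.map_map]
  have key : ∀ rs : List ℕ, (∀ r ∈ rs, 2 * (encItem (r, (r - 1).primeFactorsList)).length + 2 ≤ 16 * p.size + 6) →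
      (rs.map ((fun a : List Bool => 2 * a.length + 2) ∘ encItem ∘ fun r => (r, (r - 1).primeFactorsList))).sum ≤
        rs.length * (16 * p.size + 6) := by
    intro rs
    induction rs with
    | nil => intro; simp
    | cons r rs ih =>
      intro h
      have e1 := h r List.mem_cons_self
      have e2 := ih fun r' hr' => h r' (List.mem_cons_of_mem _ hr')
      simp only [List.map_cons, List.sum_cons, Function.comp_apply, List.length_cons]
      nlinarith
  refine (key _ hitem).trans ?_
  have hl : (treeList p).length ≤ 2 * p.size := by omega
  nlinarith [hl]

end Analysis

end PrimesUP

open PrimesUP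

/-! ### `PRIMES ∈ UP` -/

/-- The verifier's language. [cite: FellowsKoblitz1992, §2 (proof of Thm. 1)] -/
def PrimesUpVer (T : List Bool → List Bool) : Language Bool := {w | primesUpFn T w = [true]}

/-- `PrimesUpVer T ∈ P`. [cite: AroraBarakCC2009, §1.3] -/
theorem PrimesUpVer_mem_P {T : List Bool → List Bool} (hT : IsFactoredPrimalityTest T) : PrimesUpVer T ∈ P :=
  mem_P_of_mem_FP (primesUpFn_mem_FP hT.mem_FP hT.oneBit) _ fun _ =>
    ⟨fun h => h, fun h => (oneBit_primesUpFn hT.oneBit).eq_false_of_ne_true h⟩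

/-- The witness-length bound as a polynomial. [folklore] -/
noncomputable def primesWitPoly : Polynomial ℕ := 32 * X ^ 2 + 12 * X

/-- **`PRIMES ∈ UP` from a polynomial-time primality test for factored `p − 1`**: the certificate of
`p` is the vertex set of its Lucas tree in increasing order, each vertex `r` with the prime
factorisation of `r − 1` (Fellows–Koblitz's choice-free form of Pratt's certificate); it is checked in
polynomial time by `primesUpFn T` and it is the only accepted string. [cite: FellowsKoblitz1992, §2 (Lemma 1 and proof of Thm. 1)] -/
theorem PRIMES_mem_UP_of_isFactoredPrimalityTest {T : List Bool → List Bool} (hT : IsFactoredPrimalityTest T) :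
    PRIMES ∈ UP := by
  refine ⟨PrimesUpVer T, PrimesUpVer_mem_P hT, primesWitPoly, fun x => ?_, fun x => ?_⟩
  · constructor
    · rintro ⟨p, hp, rfl⟩
      have hp' : p.Prime := hp
      refine ⟨primesWit p, ?_, primesUpFn_primesWit hT hp'⟩
      show (primesWit p).length ≤ primesWitPoly.eval (encodeNat p).length
      rw [TM2Pass.length_encodeNat_eq_size, primesWitPoly]
      simpa using length_primesWit_le hp'
    · rintro ⟨y, -, hy⟩
      obtain ⟨hx, hprime, -⟩ := eq_primesWit_of_primesUpFn hT (show primesUpFn T (boolPair x y) = [true] from hy)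
      rw [hx]
      exact ⟨bitsToNat x, hprime, rfl⟩
  · rintro y ⟨-, hy⟩ y' ⟨-, hy'⟩
    obtain ⟨-, -, h1⟩ := eq_primesWit_of_primesUpFn hT (show primesUpFn T (boolPair x y) = [true] from hy)
    obtain ⟨-, -, h2⟩ := eq_primesWit_of_primesUpFn hT (show primesUpFn T (boolPair x y') = [true] from hy')
    rw [h1, h2]

end Literature.Computability.QuantumComplexity
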